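import Summits.QuantumFields.BalabanUV.T4Continuum.Support.SkeletonFillFull
import Summits.QuantumFields.BalabanUV.T4Continuum.Support.SkeletonPrecompTools
import Summits.QuantumFields.BalabanUV.T4Continuum.Support.BlockAverageLoopLogCore
import Summits.QuantumFields.BalabanUV.T4Continuum.Support.PrecompensatedPlaquette
import Literature.Analysis.Complex.RungeUnits
import HarnessLib

/-!
# T⁴ programme, node NE3 — kinematic refinement lemma, row R1-asm (assembly of leaf R1), part 1: THE MISMATCH OF THE
# FILLED PRE-COMPENSATED CONFIGURATION AT ONE COARSE BOND
# `‖U(z,κ) − \overline{W}(Lz,κ)‖ ≤ 3·(‖X_c(W) − X¹_c(W)‖ + ‖X₀(T)(z,κ) − X₀(U)(z,κ)‖)`,  `W = fullFill L T (rootH L T)`,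
# `T = precomp L U`, with the EXACT identification `X¹(W)(Lz,κ) = X₀(T)(z,κ)` and the first-order bound on `X₀(T) − X₀(U)`

NE3 formalisation swarm `b2b-balaban-t4-ne3-formalise-*`, LEAF PROVER 09 (unit `b2b-balaban-t4-ne3-formalise-leaf-09`),
row **R1-asm** of `t4/formal/NE3/LEAVES.md` by the owner's RULING NE3-R1-ASSEMBLY (journal 2026-08-20T07:54:03Z): the ONE
END `approxRefine_sfClass : ApproxRefine d (sfClass …) L N b c b₁ c₁ m` (socket NE3-R1, `SmoothRefineOfApprox.ApproxRefine`,
p211841) composed BY NAME from the crew's leaves.  THIS FILE is the part of the composition that is independent of the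
two crew ENDs still in flight (leaf-07's F3 small-field∕flux-gradient bounds of `fullFill`, leaf-01's flux-gradient
transport `SkeletonPrecompGrad`): the MISMATCH clause of the socket, reduced to leaf-08's loop-log law (E1) and to the
first-order pre-compensated plaquette lemma.

## The objects (all imported BY NAME; nothing is restated)
* `U` — the coarse datum (unitary, small field `a`, covariant flux gradients `≤ g`);
* `T := SkeletonPrecomp.precomp L U = expUnit(−X0 L U) · U` (leaf-01, S4c file 4), `X0 L U z κ = ((L−1)/(2L)) •
  Σ_{m≠κ} log U(∂p_{mκ}(z))` (orientation: transverse direction FIRST);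
* `W := SkeletonFillFull.fullFill L T (SkeletonFillUnitary.rootH L T)` (leaf-07 F2 over leaf-01's roots): the refined
  configuration; `hol_seg_fullFill` (chain products `= T`), `hol_plaq_fullFill_twoCell` (2-cell plaquettes = roots);
* `BlockAverageLoopLogCore.Xfirst L W q κ = (L(L−1)/2) • Σ_m plaqLog W κ m q` (leaf-08, S4e), `plaqLog W κ m q =
  log W(∂p_{mκ}(q))` — the SAME orientation as `X0`.

## Content ([folklore] bookkeeping; 0 defs, 0 sorry)
§1 **`plaqLog_fullFill_corner`**: for EVERY `m` (the diagonal term is `0 = 0`),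
`plaqLog W κ m (L•z) = L^{−2} • log T(∂p_{mκ}(z))` — below the diagonal by `hol_plaq_fullFill_twoCell` + `mlog ∘ exp`,
above it through the reversed plaquette (`hol_plaqWord_swap`, `mlog_inv_eq_neg`, `mlog_hol_plaqWord_swap`); hence
**`Xfirst_fullFill_eq_X0`**: `Xfirst L W (L•z) κ = X0 L T z κ` EXACTLY (`(L(L−1)/2)·L^{−2} = (L−1)/(2L)`).
§2 **`norm_X0_precomp_sub_X0_le`**: `‖X0 L T z κ − X0 L U z κ‖ ≤ ((L−1)/(2L))·(d−1)·2(2ξ′ + 37ξ² + 4aξ)` with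
`ξ = (d−1)a` (leaf-01's `norm_X0_le`), `ξ′ = ((L−1)/(2L))(d−1)g` (leaf-01's `norm_covGradX0_le`), by
`PrecompensatedPlaquette.norm_flux_precomp_sub_flux_le` (p211751) term by term — FIRST order in `g`, second in `a`.
§3 **`norm_sub_rescale_bavg_le`**: for ANY configuration whose chain product at `(z,κ)` is `T z κ` and ANY `U, X₀`
with `T z κ = e^{−B}U(z,κ)`: `‖U(z,κ) − \overline{W}(Lz,κ)‖ ≤ 3‖X_c(W) − B′‖·…` — precisely: with `A = Xavg L W (L•z) κ`,
`‖A‖, ‖B‖ ≤ 1/2`, `‖U(z,κ) − rescale L (bavg L W) z κ‖ ≤ 3‖A − B‖` (`e^A e^{−B} − 1 = (e^A − e^B)e^{−B}`, the tree's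
`norm_exp_sub_exp_le`, `e ≤ 3`); and the assembled one-bond mismatch **`norm_sub_rescale_bavg_fullFill_le`**:
`‖U(z,κ) − rescale L (bavg L W) z κ‖ ≤ 3(‖Xavg L W (L•z) κ − Xfirst L W (L•z) κ‖ + ‖X0 L T z κ − X0 L U z κ‖)`.
Part 2 (`ApproxRefineAssembly`) feeds leaf-08's (E1) `norm_Xavg_sub_Xfirst_le` (small field and flux gradients OF `W` —
leaf-07's F3) and §2 into §3 and reads off the socket's `m/(L^j)³`.

HONEST FRAMING.  No printed sentence is a hypothesis; every crew object is imported BY NAME; no `def … : Prop` fact, no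
definition; no `sorry`; axioms ⊆ {propext, Classical.choice, Quot.sound}.  NE3 NOT proved; `ApproxRefine`∕`SmoothRefine`
NOT proved here (the END needs F3); every headline «NE3-(A) CONDITIONAL on (H1)(H3ˢᵘᵖ)(H0)»; spine 0/9; the cell's
conditionals (`BetaPertH`, (B), G-an2-4) occur nowhere here; finite T⁴ rung (B)+1 — NOT infinite volume, NOT a mass gap,
NOT the Clay problem.  HONEST DEPENDENCY (cell page 1): continuum YM on T⁴ ⇐ BetaPertH ∧ nine spine estimates (0/9
proved); BetaPertH ⇐ (D1) ∧ (D4) ∧ CAP+tail; G-an2-4 gates asym, D1 and NE2/3/4.  PLACEMENT (human rule 2026-08-19):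
cell work under `Summits/QuantumFields/BalabanUV/`; imports tree modules only; moves nothing.
-/

set_option autoImplicit false

open scoped BigOperators Matrix Matrix.Norms.L2Operator
open NormedSpace Finset

namespace Summit.QuantumFields.BalabanUV.T4Continuum.ApproxRefineMismatch

open Literature.MathematicalPhysics.QuantumFieldTheory.Balaban1983to89
open B7Prop1Explicit B7Prop2Explicit B7Prop1Local MatrixLog UnitaryModel
open T4AveragingDeficitWall hiding Site Plane Plaq Bond
open AveragingDeficitTransport (norm_Ad_of_unitary mem_U1_of_unitary)
open SkeletonLattice SkeletonFill SkeletonFillUnitary SkeletonFillFull SkeletonPrecomp SkeletonPrecompTools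
open BlockAverageLoopLogCore (plaqLog Xfirst)
open PrecompensatedPlaquette (norm_flux_precomp_sub_flux_le)

noncomputable section

variable {d : ℕ} {n : Type*} [Fintype n] [DecidableEq n]

/-! ## §1 The corner plaquette logarithms of the filled configuration and the identification `X¹(W) = X₀(T)` -/

/-- `log (h : matrix) = rootLog` for the root `h = exp(rootLog)` of a plaquette within `a ≤ 1/4` of `1` (`L ≥ 1`).
[folklore] -/
theorem mlog_rootH {L : ℕ} (hL : 1 ≤ L) (T : B7Prop1Explicit.Site d → Fin d → (Matrix n n ℂ)ˣ)
    (z : B7Prop1Explicit.Site d) (κ ν : Fin d) {a : ℝ}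
    (hT : ‖((hol T z (plaqWord κ ν) : (Matrix n n ℂ)ˣ) : Matrix n n ℂ) - 1‖ ≤ a) (ha : a ≤ 1 / 4) :
    mlog ((rootH L T z κ ν : (Matrix n n ℂ)ˣ) : Matrix n n ℂ) = rootLog L T z κ ν := by
  have hY : ‖rootLog L T z κ ν‖ ≤ 2 * a := by
    have h := norm_rootLog_le (L := L) T z κ ν hT (by linarith)
    have h0 : 0 ≤ 2 * a := by linarith [(norm_nonneg _).trans hT]
    exact h.trans (mul_le_of_le_one_left h0 (rootCoeff_le_one hL))
  have hlog2 : ‖rootLog L T z κ ν‖ < Real.log 2 := by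
    have := Real.log_two_gt_d9; linarith
  rw [rootH, val_expUnit]
  exact B7BlockAvgLog.mlog_exp hlog2

/-- **THE CORNER PLAQUETTE LOGARITHMS OF THE FILLED CONFIGURATION**: for the 2-skeleton-lawful filling
`W = fullFill L T (rootH L T)` of a datum `T` with plaquettes within `a ≤ 1/16` of `1`, and EVERY pair of directions,
`plaqLog W κ m (L•z) = L^{−2} • log T(∂p_{mκ}(z))` (orientation `m` first on both sides; `m = κ`: `0 = 0`). [folklore] -/
theorem plaqLog_fullFill_corner {L : ℕ} {P : ℤ} {a : ℝ} {T : B7Prop1Explicit.Site d → Fin d → (Matrix n n ℂ)ˣ}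
    (hD : SkeletonDatum L P a T) (ha16 : a ≤ 1 / 16) (z : B7Prop1Explicit.Site d) (κ m : Fin d) :
    plaqLog (fullFill L T (rootH L T)) κ m ((L : ℤ) • z)
      = rootCoeff L • mlog ((hol T z (plaqWord m κ) : (Matrix n n ℂ)ˣ) : Matrix n n ℂ) := by
  have hL := hD.one_le
  have hL0 : 0 < L := hL
  have ha4 : a ≤ 1 / 4 := by linarith
  have hbase : ∀ μ ν : Fin d, (L : ℤ) • z + off2 μ ν 0 0 = (L : ℤ) • z := fun μ ν => by simp [off2]
  unfold plaqLog
  rcases lt_trichotomy m κ with hlt | heq | hgt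
  · -- below the diagonal: the corner plaquette is the root itself
    have hroot := rootH_pow hL T z m κ (lt_of_le_of_lt (hD.small_all z m κ) (by norm_num))
    have h := hol_plaq_fullFill_twoCell (L := L) (T := T) (h := rootH L T) hlt z hroot hL0 hL0
    rw [hbase] at h
    rw [h, mlog_rootH hL T z m κ (hD.small z m κ hlt.ne) ha4, rootLog]
  · -- the diagonal: both sides vanish
    subst heq
    rw [hol_plaqWord_self, hol_plaqWord_self, Units.val_one, mlog_one, smul_zero]
  · -- above the diagonal: the reversed plaquette is the inverse root
    have hroot := rootH_pow hL T z κ m (lt_of_le_of_lt (hD.small_all z κ m) (by norm_num))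
    have h := hol_plaq_fullFill_twoCell (L := L) (T := T) (h := rootH L T) hgt z hroot hL0 hL0
    rw [hbase] at h
    have hsmall : ‖((rootH L T z κ m : (Matrix n n ℂ)ˣ) : Matrix n n ℂ) - 1‖ ≤ 1 / 4 := by
      have := norm_rootH_sub_one_le hL T z κ m (hD.small z κ m hgt.ne) ha4
      have h0 : 0 ≤ 4 * a := by linarith [hD.nonneg hgt.ne]
      calc _ ≤ rootCoeff L * (4 * a) := this
        _ ≤ 1 * (4 * a) := mul_le_mul_of_nonneg_right (rootCoeff_le_one hL) h0
        _ ≤ 1 / 4 := by linarith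
    rw [hol_plaqWord_swap, h, mlog_inv_eq_neg hsmall, mlog_rootH hL T z κ m (hD.small z κ m hgt.ne) ha4, rootLog,
      mlog_hol_plaqWord_swap hD.small ha4 z hgt.ne, smul_neg]

/-- `(L(L−1)/2) · L^{−2} = (L−1)/(2L)` (`L ≥ 1`). [folklore] -/
theorem firstMoment_mul_rootCoeff {L : ℕ} (hL : 1 ≤ L) :
    (L : ℝ) * ((L : ℝ) - 1) / 2 * rootCoeff L = precompCoeff L := by
  have hL0 : (L : ℝ) ≠ 0 := by exact_mod_cast (by omega : L ≠ 0)
  unfold rootCoeff precompCoeff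
  field_simp

/-- **THE FIRST-MOMENT EXPONENT OF THE FILLED CONFIGURATION IS THE PRE-COMPENSATION OF ITS DATUM, EXACTLY**:
`Xfirst L (fullFill L T (rootH L T)) (L•z) κ = X0 L T z κ`. [folklore] -/
theorem Xfirst_fullFill_eq_X0 {L : ℕ} {P : ℤ} {a : ℝ} {T : B7Prop1Explicit.Site d → Fin d → (Matrix n n ℂ)ˣ}
    (hD : SkeletonDatum L P a T) (ha16 : a ≤ 1 / 16) (z : B7Prop1Explicit.Site d) (κ : Fin d) :
    Xfirst L (fullFill L T (rootH L T)) ((L : ℤ) • z) κ = X0 L T z κ := by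
  unfold Xfirst X0
  simp_rw [plaqLog_fullFill_corner hD ha16 z κ]
  rw [← Finset.smul_sum, smul_smul, firstMoment_mul_rootCoeff hD.one_le]
  congr 1
  symm
  apply Finset.sum_erase
  rw [hol_plaqWord_self, Units.val_one, mlog_one]

/-! ## §2 The pre-compensation of `T` against that of `U` -/

/-- **`X₀(T) − X₀(U)` IS FIRST ORDER IN THE FLUX GRADIENTS**: for unitary `U` with `SmallField U a`, `a ≤ 1/4`,
covariant flux gradients `≤ g`, `ξ := (d−1)a ≤ 1/2` and `2ξ′ + 37ξ² + 4aξ ≤ 1/4` with `ξ′ := ((L−1)/(2L))(d−1)g`: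
`‖X0 L (precomp L U) z κ − X0 L U z κ‖ ≤ ((L−1)/(2L))·(d−1)·2(2ξ′ + 37ξ² + 4aξ)`. [folklore] -/
theorem norm_X0_precomp_sub_X0_le [Nonempty n] {L : ℕ} (hL : 1 ≤ L)
    {U : B7Prop1Explicit.Site d → Fin d → (Matrix n n ℂ)ˣ} (hU : IsUnitaryCfg U) {a g : ℝ} (hs : SmallField U a)
    (ha : a ≤ 1 / 4)
    (hg : ∀ (z : B7Prop1Explicit.Site d) (μ : Fin d) (π : T4AveragingDeficitWall.Plane d), ‖covGrad U (flux U) z μ π‖ ≤ g)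
    (hξ : ((d : ℝ) - 1) * a ≤ 1 / 2)
    (hsum : 2 * (precompCoeff L * (((d : ℝ) - 1) * g)) + 37 * (((d : ℝ) - 1) * a) ^ 2
      + 4 * a * (((d : ℝ) - 1) * a) ≤ 1 / 4)
    (z : B7Prop1Explicit.Site d) (κ : Fin d) :
    ‖X0 L (precomp L U) z κ - X0 L U z κ‖
      ≤ precompCoeff L * (((d : ℝ) - 1) * (2 * (2 * (precompCoeff L * (((d : ℝ) - 1) * g))
          + 37 * (((d : ℝ) - 1) * a) ^ 2 + 4 * a * (((d : ℝ) - 1) * a)))) := by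
  have hd : 1 ≤ d := κ.pos
  set ξ : ℝ := ((d : ℝ) - 1) * a with hξdef
  set ξ' : ℝ := precompCoeff L * (((d : ℝ) - 1) * g) with hξ'def
  set E : ℝ := 2 * (2 * ξ' + 37 * ξ ^ 2 + 4 * a * ξ) with hEdef
  have hX : ∀ (y : B7Prop1Explicit.Site d) (μ : Fin d), ‖X0 L U y μ‖ ≤ ξ := fun y μ =>
    norm_X0_le hL hs (by linarith) y μ
  have hC : ∀ (y : B7Prop1Explicit.Site d) (μ ν : Fin d), ‖Ad (U y μ) (X0 L U (y + e μ) ν) - X0 L U y ν‖ ≤ ξ' :=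
    fun y μ ν => norm_covGradX0_le hL hs ha hg y μ ν
  -- per plaquette
  have hterm : ∀ m ∈ univ.erase κ,
      ‖mlog ((hol (precomp L U) z (plaqWord m κ) : (Matrix n n ℂ)ˣ) : Matrix n n ℂ)
        - mlog ((hol U z (plaqWord m κ) : (Matrix n n ℂ)ˣ) : Matrix n n ℂ)‖ ≤ E := by
    intro m hm
    have hmκ : m ≠ κ := (Finset.mem_erase.mp hm).1
    have h := norm_flux_precomp_sub_flux_le hU (X0 L U) z m κ hξ (hX _ _) (hX _ _) (hX _ _) (hX _ _)
      (hs z m κ hmκ) (hC z κ m) (hC z m κ) ha hsum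
    rw [show precomp L U = fun y μ => expUnit (-(X0 L U y μ)) * U y μ from rfl]
    exact h
  unfold X0
  rw [← smul_sub, ← Finset.sum_sub_distrib, norm_smul, Real.norm_of_nonneg (precompCoeff_nonneg hL)]
  refine mul_le_mul_of_nonneg_left ?_ (precompCoeff_nonneg hL)
  calc _ ≤ ∑ m ∈ univ.erase κ, ‖mlog ((hol (precomp L U) z (plaqWord m κ) : (Matrix n n ℂ)ˣ) : Matrix n n ℂ)
        - mlog ((hol U z (plaqWord m κ) : (Matrix n n ℂ)ˣ) : Matrix n n ℂ)‖ := norm_sum_le _ _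
    _ ≤ ∑ _m ∈ univ.erase κ, E := Finset.sum_le_sum hterm
    _ = ((d : ℝ) - 1) * E := by
        rw [Finset.sum_const, Finset.card_erase_of_mem (Finset.mem_univ κ), Finset.card_univ, Fintype.card_fin,
          nsmul_eq_mul, Nat.cast_sub hd, Nat.cast_one]

/-! ## §3 The mismatch at one coarse bond -/

/-- `‖e^A e^{−B} − 1‖ ≤ 3‖A − B‖` for `‖A‖, ‖B‖ ≤ 1/2` (`e^A e^{−B} − 1 = (e^A − e^B)e^{−B}`, `‖e^A − e^B‖ ≤ ‖A − B‖e^{1/2}`,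
`‖e^{−B}‖ ≤ e^{1/2}`, `e ≤ 3`). [folklore] -/
theorem norm_exp_mul_exp_neg_sub_one_le [Nonempty n] {A B : Matrix n n ℂ} (hA : ‖A‖ ≤ 1 / 2) (hB : ‖B‖ ≤ 1 / 2) :
    ‖exp A * exp (-B) - 1‖ ≤ 3 * ‖A - B‖ := by
  have hinv : exp B * exp (-B) = (1 : Matrix n n ℂ) := by
    have := (expUnit B).val_inv
    simpa [val_inv_expUnit] using this
  have hid : exp A * exp (-B) - 1 = (exp A - exp B) * exp (-B) := by
    rw [sub_mul, hinv]
  rw [hid]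
  have h1 := Literature.Analysis.Complex.norm_exp_sub_exp_le A B
  have h2 : ‖exp (-B)‖ ≤ Real.exp (1 / 2) :=
    B8Lemma1NonAbelian.norm_exp_le_of_norm_le (-B) (by rwa [norm_neg])
  have hmax : max ‖A‖ ‖B‖ ≤ 1 / 2 := max_le hA hB
  have he : Real.exp (1 / 2) * Real.exp (1 / 2) ≤ 3 := by
    rw [← Real.exp_add]; norm_num
    have := Real.exp_one_lt_d9; linarith
  calc ‖(exp A - exp B) * exp (-B)‖ ≤ ‖exp A - exp B‖ * ‖exp (-B)‖ := norm_mul_le _ _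
    _ ≤ (‖A - B‖ * Real.exp (max ‖A‖ ‖B‖)) * Real.exp (1 / 2) := by gcongr
    _ ≤ (‖A - B‖ * Real.exp (1 / 2)) * Real.exp (1 / 2) := by gcongr
    _ = ‖A - B‖ * (Real.exp (1 / 2) * Real.exp (1 / 2)) := by ring
    _ ≤ ‖A - B‖ * 3 := by gcongr
    _ = 3 * ‖A - B‖ := by ring

/-- **THE MISMATCH AT ONE COARSE BOND, ABSTRACTLY**: if the chain product of `W` at `(z, κ)` is `e^{−B}·U(z,κ)` with `U(z,κ)`
unitary, and `A = X_c(W)` (the exponent of (42)) and `B` have norm `≤ 1/2`, then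
`‖U(z,κ) − rescale L (bavg L W) z κ‖ ≤ 3‖A − B‖`. [folklore] -/
theorem norm_sub_rescale_bavg_le [Nonempty n] {L : ℕ} {W U : B7Prop1Explicit.Site d → Fin d → (Matrix n n ℂ)ˣ}
    (hU : IsUnitaryCfg U) (z : B7Prop1Explicit.Site d) (κ : Fin d) {B : Matrix n n ℂ}
    (hchain : hol W ((L : ℤ) • z) (seg κ L) = expUnit (-B) * U z κ)
    (hA : ‖Xavg L W ((L : ℤ) • z) κ‖ ≤ 1 / 2) (hB : ‖B‖ ≤ 1 / 2) :
    ‖((U z κ : (Matrix n n ℂ)ˣ) : Matrix n n ℂ) - ((rescale L (bavg L W) z κ : (Matrix n n ℂ)ˣ) : Matrix n n ℂ)‖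
      ≤ 3 * ‖Xavg L W ((L : ℤ) • z) κ - B‖ := by
  set A := Xavg L W ((L : ℤ) • z) κ with hAdef
  have hval : ((rescale L (bavg L W) z κ : (Matrix n n ℂ)ˣ) : Matrix n n ℂ)
      = exp A * exp (-B) * ((U z κ : (Matrix n n ℂ)ˣ) : Matrix n n ℂ) := by
    rw [rescale, bavg, hchain, Units.val_mul, Units.val_mul, val_expUnit, val_expUnit, mul_assoc]
  have hid : ((U z κ : (Matrix n n ℂ)ˣ) : Matrix n n ℂ) - ((rescale L (bavg L W) z κ : (Matrix n n ℂ)ˣ) : Matrix n n ℂ)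
      = -((exp A * exp (-B) - 1) * ((U z κ : (Matrix n n ℂ)ˣ) : Matrix n n ℂ)) := by
    rw [hval]; noncomm_ring
  rw [hid, norm_neg]
  have hU1 : ‖((U z κ : (Matrix n n ℂ)ˣ) : Matrix n n ℂ)‖ ≤ 1 := (mem_U1.mp (mem_U1_of_unitary (hU z κ))).1
  calc _ ≤ ‖exp A * exp (-B) - 1‖ * ‖((U z κ : (Matrix n n ℂ)ˣ) : Matrix n n ℂ)‖ := norm_mul_le _ _
    _ ≤ 3 * ‖A - B‖ * 1 := by gcongr; exact norm_exp_mul_exp_neg_sub_one_le hA hB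
    _ = 3 * ‖A - B‖ := mul_one _

/-- **THE MISMATCH OF THE FILLED PRE-COMPENSATED CONFIGURATION AT ONE COARSE BOND**: with `T = precomp L U`,
`W = fullFill L T (rootH L T)`, `T` a skeleton datum with plaquettes within `a_T ≤ 1/16`, and
`‖Xavg L W (L•z) κ‖, ‖X0 L U z κ‖ ≤ 1/2`:
`‖U(z,κ) − rescale L (bavg L W) z κ‖ ≤ 3·(‖Xavg L W (L•z) κ − Xfirst L W (L•z) κ‖ + ‖X0 L T z κ − X0 L U z κ‖)` —
the first summand is leaf-08's loop-log law (E1), the second is §2. [folklore] -/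
theorem norm_sub_rescale_bavg_fullFill_le [Nonempty n] {L : ℕ} {P : ℤ} {aT : ℝ}
    {U : B7Prop1Explicit.Site d → Fin d → (Matrix n n ℂ)ˣ} (hU : IsUnitaryCfg U)
    (hD : SkeletonDatum L P aT (precomp L U)) (haT : aT ≤ 1 / 16) (z : B7Prop1Explicit.Site d) (κ : Fin d)
    (hA : ‖Xavg L (fullFill L (precomp L U) (rootH L (precomp L U))) ((L : ℤ) • z) κ‖ ≤ 1 / 2)
    (hB : ‖X0 L U z κ‖ ≤ 1 / 2) :
    ‖((U z κ : (Matrix n n ℂ)ˣ) : Matrix n n ℂ)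
        - ((rescale L (bavg L (fullFill L (precomp L U) (rootH L (precomp L U)))) z κ : (Matrix n n ℂ)ˣ) : Matrix n n ℂ)‖
      ≤ 3 * (‖Xavg L (fullFill L (precomp L U) (rootH L (precomp L U))) ((L : ℤ) • z) κ
              - Xfirst L (fullFill L (precomp L U) (rootH L (precomp L U))) ((L : ℤ) • z) κ‖
            + ‖X0 L (precomp L U) z κ - X0 L U z κ‖) := by
  set T := precomp L U with hTdef
  set W := fullFill L T (rootH L T) with hWdef
  have hchain : hol W ((L : ℤ) • z) (seg κ L) = expUnit (-(X0 L U z κ)) * U z κ := by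
    rw [hWdef, hol_seg_fullFill hD.one_le z κ, hTdef]; rfl
  have h1 := norm_sub_rescale_bavg_le (L := L) (W := W) hU z κ hchain hA hB
  have hX := Xfirst_fullFill_eq_X0 hD haT z κ
  refine h1.trans ?_
  have htri : ‖Xavg L W ((L : ℤ) • z) κ - X0 L U z κ‖
      ≤ ‖Xavg L W ((L : ℤ) • z) κ - Xfirst L W ((L : ℤ) • z) κ‖ + ‖X0 L T z κ - X0 L U z κ‖ := by
    rw [← hX]; exact norm_sub_le_norm_sub_add_norm_sub _ _ _
  linarith

end

end Summit.QuantumFields.BalabanUV.T4Continuum.ApproxRefineMismatch
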